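import Literature.AlgebraicGeometry.ShimuraVarieties.UnitaryBallCauchyRiemann
import Literature.NumberTheory.Automorphic.ArchimedeanCalculus
import Literature.NumberTheory.Automorphic.WeightFormsArchRestriction
import HarnessLib

/-!
# `U(2,1)` as a linear real group and the Cauchy–Riemann criterion in Lie-derivative form

[folklore] Junction file. `Literature.NumberTheory.Automorphic.RealMatrixGroups` /
`ArchimedeanCalculus` provide, for a linear real group `H ≤ GL N A` (`RealMatrixGroup`), the
exponential `H.expMem : 𝔥 → H` and the Lie derivative
`lieDeriv ι X φ g = d/dt φ (g · ι (exp tX)) |_{t=0}` of a function on a group `G` receiving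
`ι : H →* G` (Borel–Jacquet 1979 §1.5 vocabulary, used by the theta-lift side).
`UnitaryBallCauchyRiemann` proves that a cotangent-weight function `F` on the ball `𝔹²` is holomorphic
as soon as the group function `f = toGroupFun cotangentCocycle x₀ F` on `U(2,1)` is
`ℂ`-differentiable at `0` in the exponential `𝔭`-coordinates `b ↦ g · exp X_b` (`expP`). Here:

* `BallForms.u21Lie` — `𝔲(2,1) = {X ∈ M₃(ℂ) : Xᴴ J + J X = 0}` as a real Lie subalgebra;
* `BallForms.u21Group : RealMatrixGroup ℂ (Fin 3)` — carrier the tree's `U21 ≤ GL₃(ℂ)`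
  (`UnitBallU21`), Lie algebra `u21Lie`; the structure fields (one-parameter groups by `exp_mem_U21`,
  `Ad`-stability, stability under `ᴴ`, closedness) are proved;
* `BallForms.liePMat b = X_b ∈ 𝔲(2,1)` and `expMem_smul_liePMat : exp (t X_b) = expP (t b)` — the
  one-parameter groups of `ArchimedeanCalculus` through `𝔭` ARE the exponential coordinates of
  `UnitaryBallCauchyRiemann`;
* `BallForms.lieDeriv_liePMat_apply` — for `f` real-differentiable at `0` in the coordinates `b`, the Lie
  derivative `X_w f_k (g)` is the value of the real differential: `fderiv ℝ (b ↦ f (g exp X_b)) 0 w k`;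
* `BallForms.liePMatL`, `differentiableAt_comp_expP_of_isArchSmooth` — `IsArchSmooth` functions are
  real-differentiable in the exponential `𝔭`-coordinates;
* `BallForms.mem_holomorphic_of_lieDeriv` — **Cauchy–Riemann in Lie-derivative form**: if every
  `b ↦ f (g exp X_b)` is real-differentiable at `0` and `X_{ib} f_k = i · X_b f_k` for all `g, b, k`
  (equivalently `(X_b + i X_{ib}) f = 0`: `f` is annihilated by `𝔭₋`, the lower-left block of
  `𝔤𝔩₃(ℂ)`, see the ORIENTATION CONVENTION of `UnitaryBallCauchyRiemann`), then `F ∈ holomorphic`;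
* `BallForms.mem_holomorphic_of_isArchSmooth` — the same with the differentiability hypothesis replaced
  by Borel–Jacquet smoothness `IsArchSmooth` of the coordinates of `f` (the form in which the
  analytic side states its output);
* `BallForms.isArchSmooth_comp`, `lieDeriv_comp_apply` — transport of smoothness and Lie derivatives
  along a homomorphism `ι : U(2,1) → G` (restriction to the archimedean component);
* `BallForms.mem_holWeightForms_of_isArchSmooth` — the same criterion for a WEIGHT FORM
  `f ∈ weightForms Δ K (weightOf x₀)`: conclusion `f ∈ holWeightForms Δ` (the `Hol` of the class-map datum);
* `BallForms.restrictHom_mem_holWeightForms` — **the statement facing the adelic side**: for a weight form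
  `F` on any group `G` ⊇ `ι(U(2,1))` with matched level/weight, smooth in the archimedean variable and with
  `X_{ib} F_k = i X_b F_k` on `G`, the restriction `WeightForms.restrictHom ι … F` lies in `holWeightForms Δ`.

NOT HERE: smoothness of any particular `f` (theta lifts); the converse; `K`-type bookkeeping.

References: [folklore]; Borel–Jacquet, *Automorphic forms and automorphic representations*, PSPM 33.1
(1979) §1.5 (Lie derivatives through right translation) [cite: BorelJacquet1979, §1.5] for the
vocabulary only; Bump 1997 §3.2 (2.13) for the `SL₂(ℝ)` prototype of "killed by the lowering operator ⇔
Cauchy–Riemann"; Knapp, *Lie Groups Beyond an Introduction* (2002), I.§1 Example (3) and I.§17 for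
`U(p,q)` as a closed linear group stable under conjugate transpose.
-/

set_option autoImplicit false

-- Mathlib idiom (Mathlib/Algebra/Lie/OfAssociative.lean); needed to mention Lie subalgebras of matrix algebras
attribute [local instance 100] LieRing.ofAssociativeRing

noncomputable section

open scoped Matrix MatrixGroups Matrix.Norms.Operator Topology ContDiff
open Literature.Geometry.ComplexHyperbolic Literature.Geometry.ComplexHyperbolic.BallModel
open Literature.NumberTheory.Automorphic Literature.NumberTheory.Automorphic.AutomorphyFactor

namespace Literature.AlgebraicGeometry.ShimuraVarieties

namespace BallForms


/-! ### 1. `𝔲(2,1)` and `U(2,1)` as a linear real group -/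

/-- The Lie algebra `𝔲(2,1) = {X ∈ M₃(ℂ) : Xᴴ J + J X = 0}` of `U(2,1) = {g : gᴴ J g = J}`, a real Lie
subalgebra of `M₃(ℂ)` (closed under the commutator: if `Xᴴ J = -J X`, `Yᴴ J = -J Y` then
`[X,Y]ᴴ J = -J [X,Y]`). Knapp 2002, I.§1 Example (3), I.§8. [folklore] -/
def u21Lie : LieSubalgebra ℝ (Matrix (Fin 3) (Fin 3) ℂ) where
  carrier := {X | Xᴴ * J + J * X = 0}
  add_mem' {X Y} hX hY := by
    simp only [Set.mem_setOf_eq] at hX hY ⊢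
    rw [Matrix.conjTranspose_add, Matrix.add_mul, Matrix.mul_add]
    calc Xᴴ * J + Yᴴ * J + (J * X + J * Y) = (Xᴴ * J + J * X) + (Yᴴ * J + J * Y) := by abel
      _ = 0 := by rw [hX, hY, add_zero]
  zero_mem' := by simp
  smul_mem' t X hX := by
    simp only [Set.mem_setOf_eq] at hX ⊢
    rw [Matrix.conjTranspose_smul, star_trivial, Matrix.smul_mul, Matrix.mul_smul, ← smul_add, hX,
      smul_zero]
  lie_mem' {X Y} hX hY := by
    simp only [Set.mem_setOf_eq] at hX hY ⊢
    have hX' : Xᴴ * J = -(J * X) := eq_neg_of_add_eq_zero_left hX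
    have hY' : Yᴴ * J = -(J * Y) := eq_neg_of_add_eq_zero_left hY
    rw [Ring.lie_def, Matrix.conjTranspose_sub, Matrix.conjTranspose_mul, Matrix.conjTranspose_mul,
      Matrix.sub_mul, Matrix.mul_assoc, hX', Matrix.mul_assoc Xᴴ, hY', Matrix.mul_neg, Matrix.mul_neg,
      ← Matrix.mul_assoc, ← Matrix.mul_assoc, hY', hX']
    simp only [neg_mul, neg_neg, Matrix.mul_sub, Matrix.mul_assoc]
    abel

/-- Membership in `𝔲(2,1)`. Knapp 2002, I.§1. [folklore] -/
theorem mem_u21Lie_iff (X : Matrix (Fin 3) (Fin 3) ℂ) : X ∈ u21Lie ↔ Xᴴ * J + J * X = 0 := Iff.rfl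

/-- **`U(2,1)` as a linear real group** (`RealMatrixGroup ℂ (Fin 3)`): carrier the tree's subgroup
`U21 ≤ GL₃(ℂ)`, Lie algebra `𝔲(2,1)`; one-parameter groups `exp (tX) ∈ U(2,1)` (`exp_mem_U21`),
`Ad g 𝔲(2,1) ⊆ 𝔲(2,1)`, `gᴴ ∈ U(2,1)` for `g ∈ U(2,1)` (via `J² = 1` and `mul_eq_one_comm`), and
`U(2,1)` is closed. Knapp 2002, Introduction (closed linear groups) and I.§17; VII.§2 Example 2.
[folklore] -/
def u21Group : RealMatrixGroup ℂ (Fin 3) where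
  carrier := U21
  lie := u21Lie
  expGL_smul_mem X hX t := by
    show (NormedSpace.exp (t • X))ᴴ * J * NormedSpace.exp (t • X) = J
    exact exp_mem_U21 (u21Lie.smul_mem t hX)
  conj_mem_lie g hg X hX := by
    rw [mem_u21Lie_iff] at hX ⊢
    set gm : Matrix (Fin 3) (Fin 3) ℂ := (g : Matrix (Fin 3) (Fin 3) ℂ) with hgm
    set gi : Matrix (Fin 3) (Fin 3) ℂ := ((g⁻¹ : GL (Fin 3) ℂ) : Matrix (Fin 3) (Fin 3) ℂ) with hgi
    have hg' : gmᴴ * J * gm = J := hg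
    have hmul : gm * gi = 1 := by
      rw [hgm, hgi, ← Units.val_mul, mul_inv_cancel, Units.val_one]
    have ha : gmᴴ * J = J * gi := by
      calc gmᴴ * J = gmᴴ * J * (gm * gi) := by rw [hmul, Matrix.mul_one]
        _ = J * gi := by rw [← Matrix.mul_assoc, hg']
    have hb : giᴴ * J = J * gm := by
      have := congrArg Matrix.conjTranspose ha
      simpa only [Matrix.conjTranspose_mul, Matrix.conjTranspose_conjTranspose, conjTranspose_J]
        using this.symm
    have hX' : Xᴴ * J = -(J * X) := eq_neg_of_add_eq_zero_left hX
    rw [Matrix.conjTranspose_mul, Matrix.conjTranspose_mul, Matrix.mul_assoc, Matrix.mul_assoc, ha,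
      ← Matrix.mul_assoc Xᴴ, hX', neg_mul, Matrix.mul_neg, ← Matrix.mul_assoc,
      ← Matrix.mul_assoc giᴴ J X, hb]
    simp only [Matrix.mul_assoc, neg_add_cancel]
  star_mem g hg := by
    set gm : Matrix (Fin 3) (Fin 3) ℂ := (g : Matrix (Fin 3) (Fin 3) ℂ) with hgm
    have hg' : gmᴴ * J * gm = J := hg
    show (star gm)ᴴ * J * star gm = J
    rw [Matrix.star_eq_conjTranspose, Matrix.conjTranspose_conjTranspose]
    have h1 : J * gmᴴ * J * gm = 1 := by rw [Matrix.mul_assoc J, Matrix.mul_assoc J, hg', J_mul_J]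
    have h2 : gm * (J * gmᴴ * J) = 1 :=
      mul_eq_one_comm.1 (by simpa only [Matrix.mul_assoc] using h1)
    calc gm * J * gmᴴ = gm * J * gmᴴ * (J * J) := by rw [J_mul_J, Matrix.mul_one]
      _ = gm * (J * gmᴴ * J) * J := by simp only [Matrix.mul_assoc]
      _ = J := by rw [h2, Matrix.one_mul]
  isClosed := by
    show IsClosed {g : GL (Fin 3) ℂ | (g : Matrix (Fin 3) (Fin 3) ℂ)ᴴ * J * (g : Matrix (Fin 3) (Fin 3) ℂ) = J}
    exact isClosed_eq ((Units.continuous_val.matrix_conjTranspose.mul continuous_const).mul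
      Units.continuous_val) continuous_const

/-- The carrier of `u21Group` is `U21`. [folklore] -/
@[simp] theorem u21Group_carrier : u21Group.carrier = U21 := rfl

/-- The Lie algebra of `u21Group` is `𝔲(2,1)`. [folklore] -/
@[simp] theorem u21Group_lie : u21Group.lie = u21Lie := rfl

/-! ### 2. `𝔭 ⊂ 𝔲(2,1)` and the exponential coordinates -/

/-- `X_b ∈ 𝔲(2,1)` as an element of the Lie algebra of `u21Group` (`pMat_skew`). [folklore] -/
def liePMat (b : Fin 2 → ℂ) : u21Group.lie := ⟨pMat b, pMat_skew b⟩

/-- `liePMat b = X_b` as a matrix. [folklore] -/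
@[simp] theorem coe_liePMat (b : Fin 2 → ℂ) : (liePMat b : Matrix (Fin 3) (Fin 3) ℂ) = pMat b := rfl

/-- `liePMat` is real-linear: `t • X_b = X_{tb}`. [folklore] -/
theorem smul_liePMat (t : ℝ) (b : Fin 2 → ℂ) : t • liePMat b = liePMat (t • b) :=
  Subtype.ext (show ((t • liePMat b : u21Group.lie) : Matrix (Fin 3) (Fin 3) ℂ) = pMat (t • b) by
    rw [pMat_smul]; rfl)

/-- The one-parameter group of `ArchimedeanCalculus` through `X_b` is the exponential coordinate map of
`UnitaryBallCauchyRiemann`: `exp (t X_b) = expP (t b)` in `U(2,1)`. [folklore] -/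
theorem expMem_smul_liePMat (t : ℝ) (b : Fin 2 → ℂ) : u21Group.expMem (t • liePMat b) = expP (t • b) := by
  apply Subtype.ext
  apply Units.ext
  rw [RealMatrixGroup.coe_expMem, coe_expGL, smul_liePMat, coe_liePMat]
  rfl

/-- `exp X_b = expP b` in `U(2,1)`. [folklore] -/
theorem expMem_liePMat (b : Fin 2 → ℂ) : u21Group.expMem (liePMat b) = expP b :=
  calc u21Group.expMem (liePMat b) = u21Group.expMem ((1 : ℝ) • liePMat b) :=
        congrArg u21Group.expMem (one_smul ℝ (liePMat b)).symm
    _ = expP ((1 : ℝ) • b) := expMem_smul_liePMat 1 b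
    _ = expP b := by rw [one_smul]

/-- The chart `b ↦ X_b` as a continuous real-linear map `ℂ² → 𝔲(2,1)` (the latter as a real subspace
of `M₃(ℂ)`, the domain of `IsArchSmooth`). [folklore] -/
def liePMatL : (Fin 2 → ℂ) →L[ℝ] u21Group.lie.toSubmodule :=
  LinearMap.toContinuousLinearMap
    { toFun := fun b => ⟨pMat b, pMat_skew b⟩
      map_add' := fun b b' => Subtype.ext (pMat_add b b')
      map_smul' := fun r b => Subtype.ext (pMat_smul r b) }

/-- `liePMatL b = X_b`. [folklore] -/
@[simp] theorem coe_liePMatL (b : Fin 2 → ℂ) :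
    ((liePMatL b : u21Group.lie.toSubmodule) : Matrix (Fin 3) (Fin 3) ℂ) = pMat b := rfl

/-- A function on `U(2,1)` that is smooth in the archimedean variable (`IsArchSmooth` for
`u21Group`, `ι = id`: `X ↦ φ (g exp X)` is `C^∞` on `𝔲(2,1)` for every `g`) is, a fortiori,
real-differentiable at `0` in the exponential `𝔭`-coordinates `b ↦ φ (g exp X_b)`.
Borel–Jacquet 1979 §1.1 vocabulary. [folklore] -/
theorem differentiableAt_comp_expP_of_isArchSmooth (φ : U21 → ℂ)
    (hφ : IsArchSmooth (H := u21Group) (MonoidHom.id U21) φ) (g : U21) :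
    DifferentiableAt ℝ (fun b : (Fin 2 → ℂ) => φ (g * expP b)) 0 := by
  have h := ((hφ g).comp liePMatL.contDiff).differentiable (by simp) 0
  have hfun : (fun b : (Fin 2 → ℂ) => φ (g * expP b)) =
      (fun X : u21Group.lie.toSubmodule => φ (g * (MonoidHom.id U21) (u21Group.expMem ⟨X, X.2⟩))) ∘
        liePMatL := by
    funext b
    show φ (g * expP b) = φ (g * (MonoidHom.id U21) (u21Group.expMem (liePMat b)))
    rw [expMem_liePMat]
    rfl
  rw [hfun]
  exact h

/-! ### 3. Lie derivatives along `𝔭` and the Cauchy–Riemann criterion -/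

/-- For `Φ` real-differentiable at `0`, the Lie derivative of the `k`-th coordinate of `f` along `X_w` at
`g` — `d/dt f_k (g exp (t X_w))|₀` — is the `k`-th coordinate of the real differential of
`Φ_g : b ↦ f (g exp X_b)` at `0` applied to `w`. [folklore] -/
theorem lieDeriv_liePMat_apply (f : U21 → (Fin 2 → ℂ)) (g : U21) (k : Fin 2) (w : Fin 2 → ℂ)
    (hd : DifferentiableAt ℝ (fun b : (Fin 2 → ℂ) => f (g * expP b)) 0) :
    lieDeriv (MonoidHom.id U21) (liePMat w) (fun h => f h k) g =
      fderiv ℝ (fun b : (Fin 2 → ℂ) => f (g * expP b)) 0 w k := by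
  simp only [lieDeriv, expMem_smul_liePMat]
  -- `ι = MonoidHom.id` is removed by definitional unfolding (`show`), not by `simp`
  show deriv (fun t : ℝ => f (g * expP (t • w)) k) 0 = _
  have h1 : HasFDerivAt (fun b : (Fin 2 → ℂ) => f (g * expP b))
      (fderiv ℝ (fun b : (Fin 2 → ℂ) => f (g * expP b)) 0) ((0 : ℝ) • w) := by
    rw [zero_smul]; exact hd.hasFDerivAt
  have h2 := h1.comp_hasDerivAt (0 : ℝ) ((hasDerivAt_id (0 : ℝ)).smul_const w)
  have h3 : HasDerivAt (fun t : ℝ => f (g * expP (t • w)))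
      (fderiv ℝ (fun b : (Fin 2 → ℂ) => f (g * expP b)) 0 w) 0 := by
    rw [one_smul] at h2; exact h2
  have h4 : HasDerivAt (fun t : ℝ => f (g * expP (t • w)) k)
      (fderiv ℝ (fun b : (Fin 2 → ℂ) => f (g * expP b)) 0 w k) 0 :=
    ((ContinuousLinearMap.proj (R := ℝ) (φ := fun _ : Fin 2 => ℂ) k).hasFDerivAt).comp_hasDerivAt
      (0 : ℝ) h3
  exact h4.deriv

/-- **Cauchy–Riemann on the ball in Lie-derivative form (cotangent weight).** Let `F : 𝔹² → ℂ²` with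
group function `f = toGroupFun cotangentCocycle x₀ F` on `U(2,1)`. If for every `g` the function
`b ↦ f (g exp X_b)` is real-differentiable at `b = 0`, and the right Lie derivatives along `𝔭` satisfy
`X_{ib} f_k = i · X_b f_k` for all `g`, `b`, `k` — i.e. `(X_b + i X_{ib}) f = 0`, `f` is killed by
`𝔭₋` — then `F` is holomorphic on the ball. (`SL₂` prototype: Bump 1997 §3.2 (2.13).) [folklore] -/
theorem mem_holomorphic_of_lieDeriv (F : Ball → (Fin 2 → ℂ))
    (hd : ∀ g : U21, DifferentiableAt ℝ (fun b : (Fin 2 → ℂ) => toGroupFun cotangentCocycle x₀ F (g * expP b)) 0)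
    (hCR : ∀ (g : U21) (b : Fin 2 → ℂ) (k : Fin 2),
      lieDeriv (MonoidHom.id U21) (liePMat (Complex.I • b))
          (fun h => toGroupFun cotangentCocycle x₀ F h k) g =
        Complex.I * lieDeriv (MonoidHom.id U21) (liePMat b)
          (fun h => toGroupFun cotangentCocycle x₀ F h k) g) :
    F ∈ holomorphic (Fin 2 → ℂ) := by
  refine mem_holomorphic_of_cauchyRiemann F hd fun g v => ?_
  funext k
  have h := hCR g v k
  rw [lieDeriv_liePMat_apply _ g k _ (hd g), lieDeriv_liePMat_apply _ g k _ (hd g)] at h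
  rw [h, Pi.smul_apply, smul_eq_mul]

/-- **Cauchy–Riemann on the ball, Borel–Jacquet form.** If every coordinate `f_k` of the group function
`f = toGroupFun cotangentCocycle x₀ F` is smooth in the archimedean variable (`IsArchSmooth` for
`U(2,1)`) and `X_{ib} f_k = i · X_b f_k` for all `g, b, k` (annihilation by `𝔭₋`), then `F` is a
holomorphic cotangent-weight function on the ball. [folklore] -/
theorem mem_holomorphic_of_isArchSmooth (F : Ball → (Fin 2 → ℂ))
    (hs : ∀ k : Fin 2,
      IsArchSmooth (H := u21Group) (MonoidHom.id U21) fun h => toGroupFun cotangentCocycle x₀ F h k)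
    (hCR : ∀ (g : U21) (b : Fin 2 → ℂ) (k : Fin 2),
      lieDeriv (MonoidHom.id U21) (liePMat (Complex.I • b))
          (fun h => toGroupFun cotangentCocycle x₀ F h k) g =
        Complex.I * lieDeriv (MonoidHom.id U21) (liePMat b)
          (fun h => toGroupFun cotangentCocycle x₀ F h k) g) :
    F ∈ holomorphic (Fin 2 → ℂ) :=
  mem_holomorphic_of_lieDeriv F
    (fun g => differentiableAt_pi.2 fun k =>
      differentiableAt_comp_expP_of_isArchSmooth (fun h => toGroupFun cotangentCocycle x₀ F h k) (hs k) g)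
    hCR

/-! ### 4. Transport along a homomorphism `ι : U(2,1) → G` and the statements for weight forms -/

/-- Restriction along `ι : U(2,1) → G` preserves smoothness in the archimedean variable: if
`X ↦ φ (x · ι (exp X))` is smooth on `𝔲(2,1)` for every `x : G`, then so is `X ↦ φ (ι (h · exp X))` for
every `h ∈ U(2,1)`. [folklore] -/
theorem isArchSmooth_comp {G : Type*} [Group G] (ι : U21 →* G) {φ : G → ℂ}
    (hφ : IsArchSmooth (H := u21Group) ι φ) :
    IsArchSmooth (H := u21Group) (MonoidHom.id U21) fun h => φ (ι h) := by
  intro h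
  have key : (fun X : u21Group.lie.toSubmodule =>
      φ (ι (h * (MonoidHom.id U21) (u21Group.expMem ⟨X, X.2⟩)))) =
      fun X : u21Group.lie.toSubmodule => φ (ι h * ι (u21Group.expMem ⟨X, X.2⟩)) := by
    funext X
    rw [map_mul]
    rfl
  show ContDiff ℝ ∞ fun X : u21Group.lie.toSubmodule =>
      φ (ι (h * (MonoidHom.id U21) (u21Group.expMem ⟨X, X.2⟩)))
  rw [key]
  exact hφ (ι h)

/-- Lie derivatives commute with restriction along `ι`: `X (φ ∘ ι) (h) = (X φ) (ι h)`. [folklore] -/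
theorem lieDeriv_comp_apply {G : Type*} [Group G] (ι : U21 →* G) (X : u21Group.lie) (φ : G → ℂ)
    (h : U21) :
    lieDeriv (MonoidHom.id U21) X (fun y => φ (ι y)) h = lieDeriv ι X φ (ι h) := by
  simp only [lieDeriv]
  congr 1
  funext t
  show φ (ι (h * (MonoidHom.id U21) (u21Group.expMem (t • X)))) =
      φ (ι h * ι (u21Group.expMem (t • X)))
  rw [map_mul]
  rfl

/-- **Holomorphy of a cotangent-weight form on `U(2,1)` from its Lie derivatives.** A weight form
`f ∈ weightForms Δ K (weightOf x₀)` (`K = Stab(x₀)`, cotangent cocycle) whose coordinates are smooth in the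
archimedean variable and satisfy `X_{ib} f_k = i · X_b f_k` (annihilation by `𝔭₋`) lies in
`holWeightForms Δ` — the space `Hol` of the class-map datum of the ball quotient. The section of the orbit
map used by `mem_holWeightForms_iff` is irrelevant (any choice). [folklore] -/
theorem mem_holWeightForms_of_isArchSmooth {Δ : Subgroup U21}
    (f : Literature.NumberTheory.Automorphic.weightForms Δ (MulAction.stabilizer U21 x₀).subtype
      (isPullbackCocycle_cotangentCocycle.weightOf x₀))
    (hs : ∀ k : Fin 2,
      IsArchSmooth (H := u21Group) (MonoidHom.id U21) fun h => (f : U21 → (Fin 2 → ℂ)) h k)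
    (hCR : ∀ (g : U21) (b : Fin 2 → ℂ) (k : Fin 2),
      lieDeriv (MonoidHom.id U21) (liePMat (Complex.I • b)) (fun h => (f : U21 → (Fin 2 → ℂ)) h k) g =
        Complex.I *
          lieDeriv (MonoidHom.id U21) (liePMat b) (fun h => (f : U21 → (Fin 2 → ℂ)) h k) g) :
    f ∈ holWeightForms Δ isPullbackCocycle_cotangentCocycle := by
  obtain ⟨s, hsec⟩ : ∃ s : Ball → U21, ∀ z, s z • x₀ = z :=
    ⟨fun z => (exists_smul_x₀_eq z).choose, fun z => (exists_smul_x₀_eq z).choose_spec⟩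
  rw [mem_holWeightForms_iff isPullbackCocycle_cotangentCocycle hsec]
  have hF : toGroupFun cotangentCocycle x₀
      (((factorFormsEquiv isPullbackCocycle_cotangentCocycle hsec).symm f :
        factorForms Δ cotangentCocycle) : Ball → (Fin 2 → ℂ)) = (f : U21 → (Fin 2 → ℂ)) :=
    congrArg
      (fun g : Literature.NumberTheory.Automorphic.weightForms Δ (MulAction.stabilizer U21 x₀).subtype
        (isPullbackCocycle_cotangentCocycle.weightOf x₀) => (g : U21 → (Fin 2 → ℂ)))
      (toGroup_ofGroup isPullbackCocycle_cotangentCocycle hsec f)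
  refine mem_holomorphic_of_isArchSmooth _ (fun k => ?_) (fun g b k => ?_)
  · rw [hF]; exact hs k
  · rw [hF]; exact hCR g b k

/-- **The statement facing the adelic side.** Let `ι : U(2,1) → G` be a homomorphism along which level
and weight are matched (`WeightForms.IsLevelCorrected`, `IsWeightMatched`, cotangent weight at `x₀`), and
`F` a weight form on `G` whose coordinates are smooth in the archimedean variable w.r.t. `ι` and satisfy
`X_{ib} F_k = i · X_b F_k` on all of `G` (annihilation by `𝔭₋ ⊂ 𝔲(2,1)_ℂ`). Then the restricted form
`F ∘ ι = WeightForms.restrictHom ι … F` is a holomorphic cotangent-weight form: it lies in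
`holWeightForms Δ`. [folklore] -/
theorem restrictHom_mem_holWeightForms {G Kc : Type*} [Group G] [Group Kc] {ΓU : Subgroup G}
    {κ : Kc →* G} {τ : Representation ℂ Kc (Fin 2 → ℂ)} (ι : U21 →* G) {Δ : Subgroup U21}
    (hΔ : WeightForms.IsLevelCorrected ΓU κ τ ι Δ) {η₁ : MulAction.stabilizer U21 x₀ →* Kc}
    (hη : WeightForms.IsWeightMatched κ τ ι (MulAction.stabilizer U21 x₀).subtype
      (isPullbackCocycle_cotangentCocycle.weightOf x₀) η₁)
    (F : Literature.NumberTheory.Automorphic.weightForms ΓU κ τ)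
    (hs : ∀ k : Fin 2, IsArchSmooth (H := u21Group) ι fun x => (F : G → (Fin 2 → ℂ)) x k)
    (hCR : ∀ (x : G) (b : Fin 2 → ℂ) (k : Fin 2),
      lieDeriv ι (liePMat (Complex.I • b)) (fun y => (F : G → (Fin 2 → ℂ)) y k) x =
        Complex.I * lieDeriv ι (liePMat b) (fun y => (F : G → (Fin 2 → ℂ)) y k) x) :
    WeightForms.restrictHom ι hΔ hη F ∈ holWeightForms Δ isPullbackCocycle_cotangentCocycle :=
  mem_holWeightForms_of_isArchSmooth _ (fun k => isArchSmooth_comp ι (hs k)) fun g b k => by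
    have h1 : lieDeriv (MonoidHom.id U21) (liePMat (Complex.I • b))
          (fun y => (F : G → (Fin 2 → ℂ)) (ι y) k) g =
        lieDeriv ι (liePMat (Complex.I • b)) (fun y => (F : G → (Fin 2 → ℂ)) y k) (ι g) :=
      lieDeriv_comp_apply ι _ (fun y => (F : G → (Fin 2 → ℂ)) y k) g
    have h2 : lieDeriv (MonoidHom.id U21) (liePMat b) (fun y => (F : G → (Fin 2 → ℂ)) (ι y) k) g =
        lieDeriv ι (liePMat b) (fun y => (F : G → (Fin 2 → ℂ)) y k) (ι g) :=
      lieDeriv_comp_apply ι _ (fun y => (F : G → (Fin 2 → ℂ)) y k) g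
    show lieDeriv (MonoidHom.id U21) (liePMat (Complex.I • b))
        (fun y => (F : G → (Fin 2 → ℂ)) (ι y) k) g =
      Complex.I * lieDeriv (MonoidHom.id U21) (liePMat b) (fun y => (F : G → (Fin 2 → ℂ)) (ι y) k) g
    rw [h1, h2]
    exact hCR (ι g) b k

end BallForms

end Literature.AlgebraicGeometry.ShimuraVarieties
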